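import Summits.Ventures.HSemireg.WedgeHankelRecurrenceGaussStieltjesRemainder

/-!
# Venture HSemireg — **THE SPECTRAL MEASURE OF THE JACOBI MATRIX: `(J_m^p)_{00} = Σ_k λ_k z_k^p` FOR EVERY `p`**: for a positive recurrence `(a, b, q)`, the Favard rule `(λ, z)` on the zeros of
# `q_{m+1}` (weights `λ_k > 0`, `Σ λ_k = 1`, making `q_0, …, q_m` orthogonal with norms `h_j = b_1 ⋯ b_j`) is the spectral measure of `(J_m, e_0)`: the `(0,0)` entry of `J_m^p` is its `p`-th moment
# for ALL `p` (not only `p ≤ 2m + 1`), hence `(P(J_m))_{00} = Σ_k λ_k P(z_k)` for every polynomial `P`; and `q_{m+1}(J_m) = 0` (Cayley–Hamilton)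

HONEST FRAMING. Part of the Lean index of the computation cell `pub-hsemireg` (seat p10 gen 43, Sunday typer «UNIFORM-IN-n»).  Square real matrices (powers, inverse, `aeval`) and real
polynomials only; no variety, no cohomology theory, no sheaf, no Ext group and no semiregularity map is constructed here; nothing here says that HC / HC_CM / HC_AV holds; no Literature fact
(unproved `Prop`) is declared or used.  Custodian versions as in `WedgeHankelSiegelIdeal` (1/3).
SOURCES (cited).  G. H. Golub, J. H. Welsch, *Calculation of Gauss quadrature rules*, Math. Comp. 23 (1969) 221–230, §2 (`Σ w_j f(t_j) = e_1ᵀ f(T) e_1`); G. H. Golub, G. Meurant, *Matrices,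
Moments and Quadrature with Applications* (2010), Ch. 6, Thm 6.2 ∕ 6.6; W. Gautschi, *Orthogonal Polynomials: Computation and Approximation* (2004), Thm 1.31 and §3.1; N. I. Akhiezer, *The Classical
Moment Problem*, Ch. IV §1 (spectral measure of a Jacobi matrix); B. Simon, *The classical moment problem as a self-adjoint finite difference operator*, Adv. Math. 137 (1998) §1.
PROOF TYPED HERE.  N300: `J^p U = U diag(z^p)` and `U diag(λ) Uᵀ = diag(h)` with `U_{jk} = q_j(z_k)`; hence `U⁻¹ = diag(λ) Uᵀ diag(h)⁻¹` and `(J^p)_{00} = Σ_k U_{0k} z_k^p (U⁻¹)_{k0} = Σ_k λ_k z_k^p`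
(`q_0 = 1`, `h_0 = 1`); linearity (`Polynomial.aeval_eq_sum_range`) gives `(P(J))_{00}`; `q_{m+1}(J) = 0` is Mathlib `Matrix.aeval_self_charpoly` with N293 `charpoly_jacobi`.
DEDUP DISCLOSURE (`rg -n 'jacobi_pow_zero_zero|aeval_jacobi|spectral_measure' Summits/Ventures/HSemireg`, 2026-09-03): N300 has `tr J^p = Σ z^p` and the conjugation; N310 the resolvent entry;
the moment ∕ `aeval` entries and Cayley–Hamilton for `q_{m+1}` are new.  The 4 names below: 0 hits tree-wide.

WHAT IS IN THE TREE.  N280 `favard_finite`; N279 `recurrence_monic_natDegree`, `eq_prod_X_sub_C_of_monic_of_roots`; N293 `charpoly_jacobi`; N300 `jacobi_pow_mul_evalMatrix`; Mathlib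
`Matrix.inv_eq_right_inv`, `Matrix.diagonal_mul_diagonal`, `Matrix.mul_diagonal`, `Matrix.diagonal_mul`, `Matrix.aeval_self_charpoly`, `Polynomial.aeval_eq_sum_range`, `Matrix.sum_apply`.
THIS FILE (namespace `Summit.Ventures.HSemireg.Wedge.HankelOuter` continued; CHAINED on N314 (import), N280, N293, N300; 0 definitions):
* §1080 `aeval_jacobi_recurrence_eq_zero` (`q_{m+1}(J_m) = 0`), **`jacobi_pow_zero_zero`** (GOLUB–WELSCH ∕ SPECTRAL MEASURE: `∃` Favard rule `(λ, z)` — `z` the zeros of `q_{m+1}`, `λ > 0`, `Σ λ = 1`,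
  dual orthogonality — with `(J_m^p)_{00} = Σ_k λ_k z_k^p` for every `p`), **`aeval_jacobi_zero_zero`** (`(P(J_m))_{00} = Σ_k λ_k P(z_k)` for every polynomial `P`, same rule).
CAVEATS.  Favard normalisation `Σ λ = 1`; for the Jacobi matrix of a positive discrete measure with `h_0 = Σ ν` the same identities hold after scaling (N299 ∕ N308).  Nothing Ext-side.  New names only.
-/

open Module Polynomial
open scoped Matrix Polynomial

namespace Summit.Ventures.HSemireg.Wedge.HankelOuter

/-! ## §1080. `(J_m^p)_{00} = Σ_k λ_k z_k^p`: the Favard rule is the spectral measure of `(J_m, e_0)` -/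

/-- **`q_{m+1}(J_m) = 0`** (Cayley–Hamilton for the Jacobi matrix, whose characteristic polynomial is `q_{m+1}` by N293). [Gautschi Thm 1.31; this file, §1080] -/
theorem aeval_jacobi_recurrence_eq_zero {q : ℕ → ℝ[X]} {a b : ℕ → ℝ} (hq0 : q 0 = 1) (hq1 : q 1 = Polynomial.X - C (a 0))
    (hrec : ∀ n, q (n + 2) = (Polynomial.X - C (a (n + 1))) * q (n + 1) - C (b (n + 1)) * q n) {m : ℕ} {J : Matrix (Fin (m + 1)) (Fin (m + 1)) ℝ}
    (hJ : ∀ i j : Fin (m + 1), J i j = if (i : ℕ) = j then a i else if (j : ℕ) = i + 1 then 1 else if (i : ℕ) = j + 1 then b i else 0) :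
    aeval J (q (m + 1)) = 0 := by
  rw [← charpoly_jacobi hq0 hq1 hrec hJ]
  exact Matrix.aeval_self_charpoly J

/-- **GOLUB–WELSCH ∕ THE SPECTRAL MEASURE OF `(J_m, e_0)`.**  For a positive recurrence there are `z_0 < ⋯ < z_m` (the zeros of `q_{m+1}`) and `λ_k > 0` with `Σ_k λ_k = 1` and
`Σ_k λ_k q_i(z_k) q_j(z_k) = δ_{ij} b_1⋯b_j` (`i, j ≤ m`) such that `(J_m^p)_{00} = Σ_k λ_k z_k^p` for EVERY `p ∈ ℕ`. [Golub–Welsch 1969 §2; Golub–Meurant Thm 6.2; Akhiezer IV §1; this file, §1080] -/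
theorem jacobi_pow_zero_zero {q : ℕ → ℝ[X]} {a b : ℕ → ℝ} (hq0 : q 0 = 1) (hq1 : q 1 = Polynomial.X - C (a 0))
    (hrec : ∀ n, q (n + 2) = (Polynomial.X - C (a (n + 1))) * q (n + 1) - C (b (n + 1)) * q n) (hb : ∀ j, 0 < b j) {m : ℕ} {J : Matrix (Fin (m + 1)) (Fin (m + 1)) ℝ}
    (hJ : ∀ i j : Fin (m + 1), J i j = if (i : ℕ) = j then a i else if (j : ℕ) = i + 1 then 1 else if (i : ℕ) = j + 1 then b i else 0) :
    ∃ z μ : Fin (m + 1) → ℝ, StrictMono z ∧ (∀ k, (q (m + 1)).eval (z k) = 0) ∧ (∀ k, 0 < μ k) ∧ ∑ k, μ k = 1 ∧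
      (∀ i j : Fin (m + 1), ∑ k, μ k * ((q i).eval (z k) * (q j).eval (z k)) = if i = j then ∏ l ∈ Finset.Ico 1 ((j : ℕ) + 1), b l else 0) ∧
      ∀ p : ℕ, (J ^ p) 0 0 = ∑ k, μ k * z k ^ p := by
  obtain ⟨z, μ, hz, hzr, hμ, hsum, hpair⟩ := favard_finite hq0 hq1 hrec hb m
  refine ⟨z, μ, hz, hzr, hμ, hsum, hpair, fun p => ?_⟩
  have hmd := recurrence_monic_natDegree hq0 hq1 hrec (m + 1)
  have hzq : q (m + 1) = ∏ k, (Polynomial.X - C (z k)) := eq_prod_X_sub_C_of_monic_of_roots hmd.1 hmd.2 hz.injective hzr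
  set U : Matrix (Fin (m + 1)) (Fin (m + 1)) ℝ := Matrix.of (fun j k : Fin (m + 1) => (q j).eval (z k)) with hU
  set h : Fin (m + 1) → ℝ := fun j => ∏ l ∈ Finset.Ico 1 ((j : ℕ) + 1), b l with hh
  have hhpos : ∀ j, 0 < h j := fun j => Finset.prod_pos fun l _ => hb l
  -- `U diag(λ) Uᵀ = diag(h)` (entrywise, from the Favard orthogonality)
  have hUU : U * Matrix.diagonal μ * Uᵀ = Matrix.diagonal h := by
    ext i j
    rw [Matrix.mul_apply, Matrix.diagonal_apply]
    simp only [Matrix.mul_diagonal, Matrix.of_apply, Matrix.transpose_apply, hU]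
    have hp := hpair i j
    have hrhs : (if i = j then ∏ l ∈ Finset.Ico 1 ((j : ℕ) + 1), b l else (0 : ℝ)) = if i = j then h i else 0 := by
      split_ifs with hij
      · rw [hij]
      · rfl
    rw [hrhs] at hp
    rw [← hp]
    exact Finset.sum_congr rfl fun k _ => by ring
  -- `U⁻¹ = diag(λ) Uᵀ diag(h)⁻¹`
  have hinv : U⁻¹ = Matrix.diagonal μ * Uᵀ * Matrix.diagonal (fun j => (h j)⁻¹) := by
    refine Matrix.inv_eq_right_inv ?_
    rw [← Matrix.mul_assoc, ← Matrix.mul_assoc, hUU, Matrix.diagonal_mul_diagonal]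
    convert Matrix.diagonal_one with j
    exact mul_inv_cancel₀ (hhpos j).ne'
  have hdet : IsUnit U.det := isUnit_iff_ne_zero.2 (det_evalMatrix_ne_zero hq0 hq1 hrec hb hz hzq)
  have hpow : J ^ p = U * Matrix.diagonal (fun k => z k ^ p) * U⁻¹ := by
    rw [← jacobi_pow_mul_evalMatrix hq0 hq1 hrec hJ hzr p, Matrix.mul_assoc, Matrix.mul_nonsing_inv _ hdet, Matrix.mul_one]
  rw [hpow, hinv, Matrix.mul_apply]
  refine Finset.sum_congr rfl fun k _ => ?_
  have h0 : h 0 = 1 := by simp [hh]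
  have hq00 : (q ((0 : Fin (m + 1)) : ℕ)).eval (z k) = 1 := by rw [Fin.val_zero, hq0, eval_one]
  rw [Matrix.mul_diagonal, Matrix.mul_diagonal, Matrix.diagonal_mul, Matrix.transpose_apply, hU]
  simp only [Matrix.of_apply]
  rw [hq00, h0, inv_one]
  ring

/-- **`(P(J_m))_{00} = Σ_k λ_k P(z_k)` for every real polynomial `P`** (the Favard rule integrates every polynomial in `J` exactly at the `(0,0)` entry). [Golub–Welsch 1969 §2; Golub–Meurant Thm 6.6;
this file, §1080] -/
theorem aeval_jacobi_zero_zero {q : ℕ → ℝ[X]} {a b : ℕ → ℝ} (hq0 : q 0 = 1) (hq1 : q 1 = Polynomial.X - C (a 0))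
    (hrec : ∀ n, q (n + 2) = (Polynomial.X - C (a (n + 1))) * q (n + 1) - C (b (n + 1)) * q n) (hb : ∀ j, 0 < b j) {m : ℕ} {J : Matrix (Fin (m + 1)) (Fin (m + 1)) ℝ}
    (hJ : ∀ i j : Fin (m + 1), J i j = if (i : ℕ) = j then a i else if (j : ℕ) = i + 1 then 1 else if (i : ℕ) = j + 1 then b i else 0) :
    ∃ z μ : Fin (m + 1) → ℝ, StrictMono z ∧ (∀ k, (q (m + 1)).eval (z k) = 0) ∧ (∀ k, 0 < μ k) ∧ ∑ k, μ k = 1 ∧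
      ∀ P : ℝ[X], (aeval J P) 0 0 = ∑ k, μ k * P.eval (z k) := by
  obtain ⟨z, μ, hz, hzr, hμ, hsum, -, hpow⟩ := jacobi_pow_zero_zero hq0 hq1 hrec hb hJ
  refine ⟨z, μ, hz, hzr, hμ, hsum, fun P => ?_⟩
  rw [aeval_eq_sum_range, Matrix.sum_apply]
  simp only [Matrix.smul_apply, smul_eq_mul, hpow, Finset.mul_sum]
  rw [Finset.sum_comm]
  refine Finset.sum_congr rfl fun k _ => ?_
  rw [eval_eq_sum_range, Finset.mul_sum]
  exact Finset.sum_congr rfl fun i _ => by ring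

end Summit.Ventures.HSemireg.Wedge.HankelOuter
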